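import Summits.Ventures.AbcSig.Rows.StatementsC1b
import Summits.Ventures.AbcSig.Rows.XnYn29Z2EvenCell
import Summits.Ventures.AbcSig.Rows.XnYn31Z2EvenCell

/-!
# Venture AbcSig — p1's named statement `Rows.C1Ext29and31EvenSigned` ASSEMBLED from the landed cell theorems (GENERATED by p-lean g5 `gen5/conj.py`)

HONEST FRAMING. COMPUTATION cell `pub-abcsig`; CONDITIONAL theorem; no claim on ABC or any summit. This file only composes:
p1's `Rows.C1Ext29and31EvenSigned` (:= `C1CellEven 29 11 ∅ ∧ C1CellEven 31 11 ∅`; rows of record census/rows/C1/C1-C29-even.md, C1-C31-even.md) from the two cell bridges.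
Hypotheses = the UNION of the cells' hypotheses verbatim (a binder name used by two cells with different statements carries a suffix `_2`, `_3`, …):
`BS04Package` (CITED), `EisPackage` / `EisChiPackage` where a cell discharges a module certificate in the kernel (CITED recipes), `DataComplete` at the
levels [1682, 1922] + the `Refines…` of kernel module certificates (COMPUTED), and 1 per-orbit CITED exclusions `hX_…`.
Where the named statement uses p1's UNREDUCED predicate `Rows.C2aCell` (all `m ≥ 1` with `n ∤ m`), the reduced cell (`Rows.C2aCellRed`, RULING H1) is
transported by the n-th-power absorption bridge `C2aCell_of_red` of `Rows/BridgeRed.lean` (bounded 2-exponent classes only).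
Cells used: `C1CellEven_29_of` (XnYn29Z2EvenCell.lean), `C1CellEven_31_of` (XnYn31Z2EvenCell.lean).
-/

namespace Summit.Ventures.AbcSig

/-- **`Rows.C1Ext29and31EvenSigned`** from the cell theorems (hypotheses = union of theirs). -/
theorem C1Ext29and31EvenSigned_of (M : NewformModel) (hP : M.BS04Package)
    (hD1682 : M.DataComplete 1682 level1682Orbits) (hD1922 : M.DataComplete 1922 level1922Orbits)
    (hX_orbit_1922_3 : ∀ n : ℕ, M.Excludes 1922 orbit_1922_3 (fun S => S.A = 1 ∧ S.B = 1 ∧ S.C = 31 ∧ S.n = n ∧ 2 ∣ S.a * S.b)) :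
    Rows.C1Ext29and31EvenSigned :=
  ⟨(C1CellEven_29_of M hP hD1682),
    (C1CellEven_31_of M hP hD1922 hX_orbit_1922_3)⟩

end Summit.Ventures.AbcSig
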